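/-
Copyright (c) 2026 the pub-hodgecm-mathlib formalisation cell (harness21).  Prover seat hodgecm-mathlib-K2E1-p10 (g0), Track B ∕ K2-LIT, h413 = `stmt-HodgeConjecture-24833`,
line `K2_E1_TraceFormulaBeta`, campaign «EIS-WHITTAKER-3», WAVE 2 letter «W-hWbd₃» FILE C3₃-A (dealer K2E1-plan (g5) RULING 2026-09-04T09:04:04Z «YES → C3₃-A TOKEN-ABSTRACT»):
THE ASSEMBLED WHITTAKER FUNCTION `W(z,ξ) = c(z)·A(z,ξ)·W_f(z,ξ)·D^{S(ξ)}(z)⁻¹` of the spherical Eisenstein series on `U(2,1)_{L∕L⁺}` SATISFIES ★ W4's (hWhol, hWbd) ON `{1 < Re z}`,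
and the Whittaker series `Σ_{ξ ∈ Lˣ} W(z,ξ)` converges locally normally and is holomorphic there — with the token letters left for W3₃-B.
-/
import Summits.HodgeConjecture.HodgeConjecture.Theorems.K2E1ArchWhittakerDecayUniformU3       -- ★ D-W2 B (K2E4-p23 g0): the archimedean product, `differentiableOn_prod_archWhittakerU3`, `exists_nhds_forall_norm_prod_archWhittakerU3_le_exp_neg_norm`
import Summits.HodgeConjecture.HodgeConjecture.Theorems.K2E1FourierJacobiSeriesConvergenceU3    -- ★ J4₃ (K2E1-p11 g0): `norm_ringEquiv_mixedSpace_algebraMap`; brings ★ W4 `K2E1WhittakerSeriesConvergenceU2`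
import Summits.HodgeConjecture.HodgeConjecture.Theorems.K2E1FractionalIdealAdelicSupport        -- ★ (K2-defs1): `exists_isCompact_of_forall_eq_zero` (the compact finite support from a box)
import HarnessLib

/-!
# K2·E1 — `K2E1WhittakerBoundsAssemblyU3` («EIS-WHITTAKER-3», «W-hWbd₃», FILE C3₃-A): `W(z,ξ) := c(z)·A(z,ξ)·W_f(z,ξ)·D_ξ(z)` MEETS ★ W4's (hWhol, hWbd) ON `{1 < Re z}`; THE
# WHITTAKER SERIES `Σ_{ξ ∈ Lˣ} W(z,ξ)` IS LOCALLY NORMALLY CONVERGENT AND HOLOMORPHIC ON THE WINDOW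

Track B ∕ K2-LIT, crux h413 = `stmt-HodgeConjecture-24833`, route of record `HCCMUnconditional`; cell `hodgecm-mathlib`, squad K2, ENGINE E1 (campaign «EIS-WHITTAKER-3», WAVE 2).
THEOREMS ONLY (no `def`, no `instance`, no notation, no named-fact hypothesis, no `sorry`; default heartbeats); lane `--supports stmt-HodgeConjecture-24833 --as helper` (count-neutral).
GENERIC number field `L` (the CM field: the Whittaker layer of `E − E_B` is indexed by `ξ ∈ Lˣ`, W0₃ CONVENTIONS 2fdd2f7063acaab9 §0 (W); ★ W4 is applied with `K := L`, `U := {1 < Re z}`).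
TOKEN-ABSTRACT BY RULING (dealer 08:54:29Z ∕ 09:04:04Z).  THE FOUR FACTORS of the `ξ`-th Whittaker coefficient `Λ(z,ξ) = c·A·(∏_{v∈S(ξ)} W_v)·D^{S(ξ)}(z)⁻¹` (★ W3₃-A
`K2E1WhittakerCoefficientEulerProductU3.whittakerCoeff_eq_prod_of_inputs`) enter as LETTERS with exactly the analytic content their ★ payers deliver:
 (c)  a scalar prefactor `c : ℂ → ℂ` (measure constants `2^d|d_L d_{L⁺}|^{−1∕2}`, the Iwasawa letters `|d|^{1−z}`, `φ₀` — W3₃-cov): holomorphic on `U`, locally bounded;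
 (A)  THE ★ ARCHIMEDEAN PRODUCT `A(z,ξ) = ∏_{i:ι} 2π²·4^{1−z}·|δ|_i⁻¹·Γ(z)⁻²·𝓜[e^{−t−8π²‖ξ_i‖²∕t}](2z−2)` (★ D-W2 B, CONCRETE) at an archimedean frequency `ξ∞ : L → (ι → ℂ)` (letter: at a
      complex place `w`, `(ξ∞ ξ)_w = w(ξ)·(torus letter)`), with the comparison letter `m·‖ξ_∞‖ ≤ ‖ξ∞ ξ‖` (`m > 0`; at the base point `m = 1` by `‖mixedEmbedding L ξ‖ = sup_w ‖w ξ‖` for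
      totally complex `L` — the N = 3 twin of ★ C3's `exists_pos_mul_norm_le_norm_lineFreq`, payer W3₃-cov);
 (F)  THE FINITE PART `F(z,ξ) = ∏_{v∈S(ξ)} Wloc ξ v z` through its three ★ C2₃-A conclusions (`K2E1WhittakerFinitePartU3.exists_finitePart_bounds_of_packages`): holomorphic on `U`
      (`ξ ≠ 0`), `‖F(z,ξ)‖ ≤ C(1+‖ξ_∞‖)^a` on `Re z ≥ σ₁` for `ξ ≠ 0` in the box `∀ w, ξ ∈ 𝔭_w^{e_w}`, zero off the box;
 (D)  THE INVERTED DENOMINATOR `D ξ z = D^{S(ξ)}(z)⁻¹ = [ζ^{S(ξ)}_L(z)·L^{S(ξ)}(2z−1,ε)]⁻¹` (★ W3₃-A `differentiableOn_den_inv_cm`, ★ DEN `K2E1WhittakerDenBoundsUniformU3`): holomorphic on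
      `U`, bounded by ONE constant on `Re z ≥ σ₁ > 1` UNIFORMLY IN `ξ` (the bound is uniform in `S ⊇ S₀`).
THE FUNCTION: `W(z,ξ) := 0` for `ξ = 0` and `c(z)·A(z, ξ∞ ξ)·F(z,ξ)·D ξ z` otherwise (the lambda in the heads; no `def`).
CONCLUSIONS (§2 HEAD **`whittaker_hWhol_hWbd_of_letters`**): `W(z,0) = 0`; (hWhol) `z ↦ W(z,ξ)` holomorphic on `U` for `ξ ≠ 0`; (hWbd) — THE ★ W4 BYTES with `K := L` — around every
`z₀ ∈ U` a neighbourhood `V`, constants `M ≥ 0`, `b > 0`, `a` and a COMPACT `Cf ⊂ 𝔸_{L,f}` (★ `exists_isCompact_of_forall_eq_zero` on the box) with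
`‖W(z,ξ)‖ ≤ M·e^{−b‖ξ_∞‖}·(1+‖ξ_∞‖)^a` for ALL `z ∈ V`, ALL `ξ : L` (`‖ξ_∞‖ = ‖ringEquiv_mixedSpace L (ξ)_∞‖ = ‖mixedEmbedding L ξ‖`, ★ `norm_ringEquiv_mixedSpace_algebraMap`) and
`W(z,ξ) = 0` when `ξ_f ∉ Cf`; (§3 **`whittaker_series_summable_differentiableOn_of_letters`**) ★ W4 `summable_differentiableOn_tsum_of_exp_bounds` APPLIED: `Σ_ξ ‖W(z,ξ)‖` summable for
`z ∈ U`, locally uniformly bounded, and `z ↦ Σ_{ξ≠0} W(z,ξ)` HOLOMORPHIC ON `{1 < Re z}`.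
PROOF OF (hWbd): on `V = V_c ∩ V_A ∩ {σ₁ < Re z}` (`σ₁ = (1+Re z₀)∕2`): `‖c‖ ≤ C_c`, `‖A‖ ≤ C_A e^{−2√2π‖ξ∞ ξ‖} ≤ C_A e^{−2√2π m‖ξ_∞‖}` (★ D-W2 B), `‖F‖ ≤ C_F(1+‖ξ_∞‖)^a` (box) resp.
`F = 0` (off the box), `‖D‖ ≤ C_D`; `M = C_c C_A C_F C_D`, `b = 2√2π·m`.
HONEST SCOPE: CONDITIONAL BY CONSTRUCTION on the letters (c)(ξ∞, m)(F)(D); the identification `W(z,ξ) = μE(D_E)⁻¹·𝓕_E[Φ^Z_g](ξ)` on `Re z > 2` (★ W4₃∕W5₃'s `hWeq`) is NOT here — it is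
W3₃-B's token instantiation composed with ★ W3₃-A; no bound on the closed half-plane `Re z ≥ 1` is claimed.
SAT-WITNESS: with `c = 1`, `F = 1` on the box `e = 0`, `D = 1`, `ξ∞ ξ = (w ξ)_w`, every hypothesis holds (★ arch bounds), so the letters are jointly satisfiable.
HONEST LABEL: HC_CM is proved only modulo the 7 printed citations (2 remaining named inputs: hLiu418 = `stmt-HodgeConjecture-24832`, h413 = `stmt-HodgeConjecture-24833`)
until rung 0 closes; this file asserts no named fact and closes no socket; count-neutral.
References: [MoeglinWaldspurger1995] I.2.10, II.1.7 · [Garrett2018] §1.10, §2.8 · [Bump1997] §3.7 · [WeilBNT1967] Ch. IV §2.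
-/

set_option autoImplicit false
-- the mandated namespace repeats the single-problem summit's segment (`HodgeConjecture.HodgeConjecture`)
set_option linter.dupNamespace false

noncomputable section

open scoped NNReal Topology Classical Real
open NumberField NumberField.mixedEmbedding IsDedekindDomain Set Filter Module
open Literature.NumberTheory.Automorphic
open Summit.HodgeConjecture.HodgeConjecture.Cruxes.H413.K2E1WhittakerSeriesConvergenceU2 (summable_differentiableOn_tsum_of_exp_bounds)
open Summit.HodgeConjecture.HodgeConjecture.Cruxes.H413.K2E1ArchWhittakerDecayUniformU3 (differentiableOn_prod_archWhittakerU3 exists_nhds_forall_norm_prod_archWhittakerU3_le_exp_neg_norm)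
open Summit.HodgeConjecture.HodgeConjecture.Cruxes.H413.K2E1FourierJacobiSeriesConvergenceU3 (norm_ringEquiv_mixedSpace_algebraMap)
open Summit.HodgeConjecture.HodgeConjecture.Cruxes.H413.K2E1FractionalIdealAdelicSupport (exists_isCompact_of_forall_eq_zero)

namespace Summit.HodgeConjecture.HodgeConjecture.Cruxes.H413.K2E1WhittakerBoundsAssemblyU3

variable (L : Type) [Field L] [NumberField L]

/-! ## §1  Scalar bookkeeping -/

omit [NumberField L] in
/-- Exponential decay transfers along `m‖x‖ ≤ ‖y‖`: `e^{−b‖y‖} ≤ e^{−(bm)‖x‖}` for `b ≥ 0`. [folklore] -/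
theorem exp_neg_mul_le_of_mul_le {b m x y : ℝ} (hb : 0 ≤ b) (h : m * x ≤ y) : Real.exp (-(b * y)) ≤ Real.exp (-(b * m * x)) := by
  rw [Real.exp_le_exp, neg_le_neg_iff, mul_assoc]
  exact mul_le_mul_of_nonneg_left h hb

/-- `(1 + ‖ξ_∞‖)^n` in natural-power and real-power spellings agree. [folklore] -/
theorem one_add_norm_pow_eq_rpow (ξ : L) (n : ℕ) :
    (1 + ‖mixedEmbedding L ξ‖) ^ n = (1 + ‖InfiniteAdeleRing.ringEquiv_mixedSpace L (algebraMap L (AdeleRing (𝓞 L) L) ξ).1‖) ^ (n : ℝ) := by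
  rw [norm_ringEquiv_mixedSpace_algebraMap, Real.rpow_natCast]

/-! ## §2  THE ASSEMBLED WHITTAKER FUNCTION MEETS (hWhol, hWbd) -/

/-- **THE ASSEMBLED WHITTAKER FUNCTION OF THE SPHERICAL EISENSTEIN SERIES ON `U(2,1)_{L∕L⁺}` — (hWhol, hWbd) FROM THE LETTERS.**  `L` a number field, `U = {1 < Re z}`; letters: the
prefactor `c` (holomorphic on `U`, locally bounded), the archimedean frequency `ξ∞ : L → (ι → ℂ)` with `m‖ξ_∞‖ ≤ ‖ξ∞ ξ‖` (`m > 0`) and `|δ|`-letters `dδ`, the finite part `F` (holomorphic on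
`U` for `ξ ≠ 0`; `‖F(z,ξ)‖ ≤ C(1+‖ξ_∞‖)^a` on `Re z ≥ σ₁` for `ξ ≠ 0` in the box `e`; zero off the box — ★ C2₃-A), the inverted denominator `D` (holomorphic on `U`; `‖D ξ z‖ ≤ C_D` on
`Re z ≥ σ₁`, uniformly in `ξ` — ★ W3₃-A ∕ ★ DEN).  For `W(z,ξ) := 𝟙[ξ ≠ 0]·c(z)·A(z, ξ∞ ξ)·F(z,ξ)·D ξ z` (`A` = ★ D-W2 B archimedean product): `W(z,0) = 0`; (hWhol) holomorphic on `U`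
for `ξ ≠ 0`; (hWbd) THE ★ W4 BYTES (`K := L`): around every `z₀ ∈ U` a neighbourhood with ONE `M ≥ 0`, `b > 0`, `a`, ONE compact `Cf ⊂ 𝔸_{L,f}`, `‖W(z,ξ)‖ ≤ M e^{−b‖ξ_∞‖}(1+‖ξ_∞‖)^a`
for all `z`, `ξ`, and `W(z,ξ) = 0` for `ξ_f ∉ Cf`. [cite: MoeglinWaldspurger1995, I.2.10] [cite: Garrett2018, §2.8] [cite: Bump1997, §3.7] [cite: WeilBNT1967, Ch. IV §2] -/
theorem whittaker_hWhol_hWbd_of_letters {ι : Type} [Fintype ι] (dδ : ι → ℝ) (ξinf : L → ι → ℂ) {m : ℝ} (hm : 0 < m)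
    (hmle : ∀ ξ : L, m * ‖mixedEmbedding L ξ‖ ≤ ‖ξinf ξ‖)
    (c : ℂ → ℂ) (hc : DifferentiableOn ℂ c {z : ℂ | 1 < z.re}) (hcbd : ∀ z₀ : ℂ, 1 < z₀.re → ∃ V ∈ 𝓝 z₀, ∃ C : ℝ, 0 ≤ C ∧ ∀ z ∈ V, ‖c z‖ ≤ C)
    (F : ℂ → L → ℂ) {e : HeightOneSpectrum (𝓞 L) → ℤ} (he : ∀ᶠ w in cofinite, e w = 0)
    (hFhol : ∀ ξ : L, ξ ≠ 0 → DifferentiableOn ℂ (fun z => F z ξ) {z : ℂ | 1 < z.re})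
    (hFbd : ∀ σ₁ : ℝ, 1 < σ₁ → ∃ (C : ℝ) (a : ℕ), 0 ≤ C ∧ ∀ ξ : L, ξ ≠ 0 →
      (∀ w : HeightOneSpectrum (𝓞 L), (ξ : w.adicCompletion L) ∈ primePowBall (w.adicCompletion L) (e w)) → ∀ z : ℂ, σ₁ ≤ z.re → ‖F z ξ‖ ≤ C * (1 + ‖mixedEmbedding L ξ‖) ^ a)
    (hFsupp : ∀ ξ : L, ξ ≠ 0 → (∃ w : HeightOneSpectrum (𝓞 L), (ξ : w.adicCompletion L) ∉ primePowBall (w.adicCompletion L) (e w)) → ∀ z : ℂ, F z ξ = 0)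
    (D : L → ℂ → ℂ) (hDhol : ∀ ξ : L, DifferentiableOn ℂ (D ξ) {z : ℂ | 1 < z.re})
    (hDbd : ∀ σ₁ : ℝ, 1 < σ₁ → ∃ C : ℝ, 0 ≤ C ∧ ∀ ξ : L, ∀ z : ℂ, σ₁ ≤ z.re → ‖D ξ z‖ ≤ C) :
    (∀ z : ℂ, (fun (z : ℂ) (ξ : L) => if ξ = 0 then (0 : ℂ) else c z *
        (∏ i, 2 * (π : ℂ) ^ 2 * (4 : ℂ) ^ (1 - z) * ((dδ i : ℝ) : ℂ)⁻¹ * (Complex.Gamma z)⁻¹ ^ 2 *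
          mellin (fun t : ℝ => Complex.exp (-(t : ℂ) - ((8 * π ^ 2 * ‖ξinf ξ i‖ ^ 2 : ℝ) : ℂ) / (t : ℂ))) (2 * z - 2)) * F z ξ * D ξ z) z 0 = 0) ∧
    (∀ ξ : L, ξ ≠ 0 → DifferentiableOn ℂ (fun z => (fun (z : ℂ) (ξ : L) => if ξ = 0 then (0 : ℂ) else c z *
        (∏ i, 2 * (π : ℂ) ^ 2 * (4 : ℂ) ^ (1 - z) * ((dδ i : ℝ) : ℂ)⁻¹ * (Complex.Gamma z)⁻¹ ^ 2 *
          mellin (fun t : ℝ => Complex.exp (-(t : ℂ) - ((8 * π ^ 2 * ‖ξinf ξ i‖ ^ 2 : ℝ) : ℂ) / (t : ℂ))) (2 * z - 2)) * F z ξ * D ξ z) z ξ) {z : ℂ | 1 < z.re}) ∧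
    (∀ z₀ ∈ {z : ℂ | 1 < z.re}, ∃ V ∈ 𝓝 z₀, ∃ (M b a : ℝ) (Cf : Set (FiniteAdeleRing (𝓞 L) L)), 0 ≤ M ∧ 0 < b ∧ IsCompact Cf ∧
      ∀ z ∈ V, ∀ ξ : L,
        ‖(fun (z : ℂ) (ξ : L) => if ξ = 0 then (0 : ℂ) else c z *
          (∏ i, 2 * (π : ℂ) ^ 2 * (4 : ℂ) ^ (1 - z) * ((dδ i : ℝ) : ℂ)⁻¹ * (Complex.Gamma z)⁻¹ ^ 2 *
            mellin (fun t : ℝ => Complex.exp (-(t : ℂ) - ((8 * π ^ 2 * ‖ξinf ξ i‖ ^ 2 : ℝ) : ℂ) / (t : ℂ))) (2 * z - 2)) * F z ξ * D ξ z) z ξ‖ ≤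
          M * Real.exp (-(b * ‖InfiniteAdeleRing.ringEquiv_mixedSpace L (algebraMap L (AdeleRing (𝓞 L) L) ξ).1‖)) *
            (1 + ‖InfiniteAdeleRing.ringEquiv_mixedSpace L (algebraMap L (AdeleRing (𝓞 L) L) ξ).1‖) ^ a ∧
        ((algebraMap L (AdeleRing (𝓞 L) L) ξ).2 ∉ Cf → (fun (z : ℂ) (ξ : L) => if ξ = 0 then (0 : ℂ) else c z *
          (∏ i, 2 * (π : ℂ) ^ 2 * (4 : ℂ) ^ (1 - z) * ((dδ i : ℝ) : ℂ)⁻¹ * (Complex.Gamma z)⁻¹ ^ 2 *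
            mellin (fun t : ℝ => Complex.exp (-(t : ℂ) - ((8 * π ^ 2 * ‖ξinf ξ i‖ ^ 2 : ℝ) : ℂ) / (t : ℂ))) (2 * z - 2)) * F z ξ * D ξ z) z ξ = 0)) := by
  -- off the box `W = 0` (★ C2₃-A (supp)); the compact `Cf` (★ `exists_isCompact_of_forall_eq_zero`)
  have hWz : ∀ (z : ℂ) (ξ : L), (∃ w : HeightOneSpectrum (𝓞 L), (ξ : w.adicCompletion L) ∉ primePowBall (w.adicCompletion L) (e w)) →
      (fun (z : ℂ) (ξ : L) => if ξ = 0 then (0 : ℂ) else c z *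
        (∏ i, 2 * (π : ℂ) ^ 2 * (4 : ℂ) ^ (1 - z) * ((dδ i : ℝ) : ℂ)⁻¹ * (Complex.Gamma z)⁻¹ ^ 2 *
          mellin (fun t : ℝ => Complex.exp (-(t : ℂ) - ((8 * π ^ 2 * ‖ξinf ξ i‖ ^ 2 : ℝ) : ℂ) / (t : ℂ))) (2 * z - 2)) * F z ξ * D ξ z) z ξ = 0 := by
    intro z ξ hξw
    by_cases hξ : ξ = 0
    · simp only [hξ, if_true]
    · simp only [if_neg hξ, hFsupp ξ hξ hξw z, mul_zero, zero_mul]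
  obtain ⟨Cf, hCfc, hCfW⟩ := exists_isCompact_of_forall_eq_zero L _ (e := e) (he.mono fun w hw => hw.symm.le) hWz
  refine ⟨fun z => by simp only [if_true], fun ξ hξ => ?_, fun z₀ hz₀ => ?_⟩
  · -- (hWhol): product of four functions holomorphic on the window
    simp only [if_neg hξ]
    exact ((hc.mul (differentiableOn_prod_archWhittakerU3 dδ (ξinf ξ))).mul (hFhol ξ hξ)).mul (hDhol ξ)
  · -- (hWbd)
    have hz₀' : 1 < z₀.re := hz₀
    set σ₁ : ℝ := (1 + z₀.re) / 2 with hσ₁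
    have hσ₁1 : 1 < σ₁ := by rw [hσ₁]; linarith
    have hσ₁z : σ₁ < z₀.re := by rw [hσ₁]; linarith
    obtain ⟨Vc, hVc, Cc, hCc, hcb⟩ := hcbd z₀ hz₀'
    obtain ⟨VA, hVA, CA, hCA, hAb⟩ := exists_nhds_forall_norm_prod_archWhittakerU3_le_exp_neg_norm dδ hz₀'
    obtain ⟨CF, a, hCF, hFb⟩ := hFbd σ₁ hσ₁1
    obtain ⟨CD, hCD, hDb⟩ := hDbd σ₁ hσ₁1
    refine ⟨Vc ∩ VA ∩ {z : ℂ | σ₁ < z.re}, Filter.inter_mem (Filter.inter_mem hVc hVA) ((isOpen_lt continuous_const Complex.continuous_re).mem_nhds hσ₁z),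
      Cc * CA * CF * CD, 2 * Real.sqrt 2 * π * m, (a : ℝ), Cf, by positivity, by positivity, hCfc, fun z hz ξ => ⟨?_, hCfW z ξ⟩⟩
    obtain ⟨⟨hzc, hzA⟩, hzσ⟩ := hz
    have hzσ' : σ₁ ≤ z.re := le_of_lt hzσ
    have hRHS : 0 ≤ Cc * CA * CF * CD * Real.exp (-(2 * Real.sqrt 2 * π * m * ‖InfiniteAdeleRing.ringEquiv_mixedSpace L (algebraMap L (AdeleRing (𝓞 L) L) ξ).1‖)) *
        (1 + ‖InfiniteAdeleRing.ringEquiv_mixedSpace L (algebraMap L (AdeleRing (𝓞 L) L) ξ).1‖) ^ (a : ℝ) := by positivity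
    by_cases hξ : ξ = 0
    · simp only [hξ, if_true, norm_zero]
      rw [hξ] at hRHS
      exact hRHS
    by_cases hbox : ∀ w : HeightOneSpectrum (𝓞 L), (ξ : w.adicCompletion L) ∈ primePowBall (w.adicCompletion L) (e w)
    · simp only [if_neg hξ]
      have hA := hAb z hzA (ξinf ξ)
      have hexp : Real.exp (-(2 * Real.sqrt 2 * π * ‖ξinf ξ‖)) ≤ Real.exp (-(2 * Real.sqrt 2 * π * m * ‖InfiniteAdeleRing.ringEquiv_mixedSpace L (algebraMap L (AdeleRing (𝓞 L) L) ξ).1‖)) := by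
        rw [norm_ringEquiv_mixedSpace_algebraMap]
        exact exp_neg_mul_le_of_mul_le (by positivity) (hmle ξ)
      have hF := hFb ξ hξ hbox z hzσ'
      rw [one_add_norm_pow_eq_rpow L ξ a] at hF
      calc ‖c z * (∏ i, 2 * (π : ℂ) ^ 2 * (4 : ℂ) ^ (1 - z) * ((dδ i : ℝ) : ℂ)⁻¹ * (Complex.Gamma z)⁻¹ ^ 2 *
            mellin (fun t : ℝ => Complex.exp (-(t : ℂ) - ((8 * π ^ 2 * ‖ξinf ξ i‖ ^ 2 : ℝ) : ℂ) / (t : ℂ))) (2 * z - 2)) * F z ξ * D ξ z‖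
          = ‖c z‖ * ‖∏ i, 2 * (π : ℂ) ^ 2 * (4 : ℂ) ^ (1 - z) * ((dδ i : ℝ) : ℂ)⁻¹ * (Complex.Gamma z)⁻¹ ^ 2 *
            mellin (fun t : ℝ => Complex.exp (-(t : ℂ) - ((8 * π ^ 2 * ‖ξinf ξ i‖ ^ 2 : ℝ) : ℂ) / (t : ℂ))) (2 * z - 2)‖ * ‖F z ξ‖ * ‖D ξ z‖ := by
            rw [norm_mul, norm_mul, norm_mul]
        _ ≤ Cc * (CA * Real.exp (-(2 * Real.sqrt 2 * π * m * ‖InfiniteAdeleRing.ringEquiv_mixedSpace L (algebraMap L (AdeleRing (𝓞 L) L) ξ).1‖))) *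
            (CF * (1 + ‖InfiniteAdeleRing.ringEquiv_mixedSpace L (algebraMap L (AdeleRing (𝓞 L) L) ξ).1‖) ^ (a : ℝ)) * CD := by
            refine mul_le_mul (mul_le_mul (mul_le_mul (hcb z hzc) (hA.trans (mul_le_mul_of_nonneg_left hexp hCA)) (norm_nonneg _) hCc) hF (norm_nonneg _)
              (by positivity)) (hDb ξ z hzσ') (norm_nonneg _) (by positivity)
        _ = Cc * CA * CF * CD * Real.exp (-(2 * Real.sqrt 2 * π * m * ‖InfiniteAdeleRing.ringEquiv_mixedSpace L (algebraMap L (AdeleRing (𝓞 L) L) ξ).1‖)) *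
            (1 + ‖InfiniteAdeleRing.ringEquiv_mixedSpace L (algebraMap L (AdeleRing (𝓞 L) L) ξ).1‖) ^ (a : ℝ) := by ring
    · rw [hWz z ξ (by push Not at hbox; exact hbox), norm_zero]
      exact hRHS

/-! ## §3  ★ W4 APPLIED: the Whittaker series on the window -/

/-- **THE WHITTAKER SERIES OF THE SPHERICAL EISENSTEIN SERIES ON `U(2,1)_{L∕L⁺}` CONVERGES LOCALLY NORMALLY AND IS HOLOMORPHIC ON `{1 < Re z}`** (from the letters of §2, via ★ W4
`summable_differentiableOn_tsum_of_exp_bounds` with `K := L`): for `W(z,ξ) := 𝟙[ξ≠0]·c(z)·A(z,ξ∞ ξ)·F(z,ξ)·D ξ z`, (i) `Σ_ξ ‖W(z,ξ)‖` is summable for every `1 < Re z`; (ii) around every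
`z₀` with `1 < Re z₀` ONE `C` bounds `Σ_{ξ≠0} ‖W(z,ξ)‖` on a neighbourhood; (iii) `z ↦ Σ_{ξ≠0} W(z,ξ)` is holomorphic on `{1 < Re z}`.
[cite: MoeglinWaldspurger1995, I.2.10] [cite: Garrett2018, §1.10] [cite: Bump1997, §3.7] -/
theorem whittaker_series_summable_differentiableOn_of_letters {ι : Type} [Fintype ι] (dδ : ι → ℝ) (ξinf : L → ι → ℂ) {m : ℝ} (hm : 0 < m)
    (hmle : ∀ ξ : L, m * ‖mixedEmbedding L ξ‖ ≤ ‖ξinf ξ‖)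
    (c : ℂ → ℂ) (hc : DifferentiableOn ℂ c {z : ℂ | 1 < z.re}) (hcbd : ∀ z₀ : ℂ, 1 < z₀.re → ∃ V ∈ 𝓝 z₀, ∃ C : ℝ, 0 ≤ C ∧ ∀ z ∈ V, ‖c z‖ ≤ C)
    (F : ℂ → L → ℂ) {e : HeightOneSpectrum (𝓞 L) → ℤ} (he : ∀ᶠ w in cofinite, e w = 0)
    (hFhol : ∀ ξ : L, ξ ≠ 0 → DifferentiableOn ℂ (fun z => F z ξ) {z : ℂ | 1 < z.re})
    (hFbd : ∀ σ₁ : ℝ, 1 < σ₁ → ∃ (C : ℝ) (a : ℕ), 0 ≤ C ∧ ∀ ξ : L, ξ ≠ 0 →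
      (∀ w : HeightOneSpectrum (𝓞 L), (ξ : w.adicCompletion L) ∈ primePowBall (w.adicCompletion L) (e w)) → ∀ z : ℂ, σ₁ ≤ z.re → ‖F z ξ‖ ≤ C * (1 + ‖mixedEmbedding L ξ‖) ^ a)
    (hFsupp : ∀ ξ : L, ξ ≠ 0 → (∃ w : HeightOneSpectrum (𝓞 L), (ξ : w.adicCompletion L) ∉ primePowBall (w.adicCompletion L) (e w)) → ∀ z : ℂ, F z ξ = 0)
    (D : L → ℂ → ℂ) (hDhol : ∀ ξ : L, DifferentiableOn ℂ (D ξ) {z : ℂ | 1 < z.re})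
    (hDbd : ∀ σ₁ : ℝ, 1 < σ₁ → ∃ C : ℝ, 0 ≤ C ∧ ∀ ξ : L, ∀ z : ℂ, σ₁ ≤ z.re → ‖D ξ z‖ ≤ C) :
    (∀ z ∈ {z : ℂ | 1 < z.re}, Summable fun ξ : L => ‖(fun (z : ℂ) (ξ : L) => if ξ = 0 then (0 : ℂ) else c z *
        (∏ i, 2 * (π : ℂ) ^ 2 * (4 : ℂ) ^ (1 - z) * ((dδ i : ℝ) : ℂ)⁻¹ * (Complex.Gamma z)⁻¹ ^ 2 *
          mellin (fun t : ℝ => Complex.exp (-(t : ℂ) - ((8 * π ^ 2 * ‖ξinf ξ i‖ ^ 2 : ℝ) : ℂ) / (t : ℂ))) (2 * z - 2)) * F z ξ * D ξ z) z ξ‖) ∧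
    (∀ z₀ ∈ {z : ℂ | 1 < z.re}, ∃ V ∈ 𝓝 z₀, ∃ C : ℝ, ∀ z ∈ V, ∑' ξ : L, ({0}ᶜ : Set L).indicator (fun ξ => ‖(fun (z : ℂ) (ξ : L) => if ξ = 0 then (0 : ℂ) else c z *
        (∏ i, 2 * (π : ℂ) ^ 2 * (4 : ℂ) ^ (1 - z) * ((dδ i : ℝ) : ℂ)⁻¹ * (Complex.Gamma z)⁻¹ ^ 2 *
          mellin (fun t : ℝ => Complex.exp (-(t : ℂ) - ((8 * π ^ 2 * ‖ξinf ξ i‖ ^ 2 : ℝ) : ℂ) / (t : ℂ))) (2 * z - 2)) * F z ξ * D ξ z) z ξ‖) ξ ≤ C) ∧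
    DifferentiableOn ℂ (fun z => ∑' ξ : L, ({0}ᶜ : Set L).indicator (fun ξ => (fun (z : ℂ) (ξ : L) => if ξ = 0 then (0 : ℂ) else c z *
        (∏ i, 2 * (π : ℂ) ^ 2 * (4 : ℂ) ^ (1 - z) * ((dδ i : ℝ) : ℂ)⁻¹ * (Complex.Gamma z)⁻¹ ^ 2 *
          mellin (fun t : ℝ => Complex.exp (-(t : ℂ) - ((8 * π ^ 2 * ‖ξinf ξ i‖ ^ 2 : ℝ) : ℂ) / (t : ℂ))) (2 * z - 2)) * F z ξ * D ξ z) z ξ) ξ) {z : ℂ | 1 < z.re} := by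
  obtain ⟨-, hWhol, hWbd⟩ := whittaker_hWhol_hWbd_of_letters L dδ ξinf hm hmle c hc hcbd F he hFhol hFbd hFsupp D hDhol hDbd
  exact summable_differentiableOn_tsum_of_exp_bounds L (isOpen_lt continuous_const Complex.continuous_re) hWhol hWbd

end Summit.HodgeConjecture.HodgeConjecture.Cruxes.H413.K2E1WhittakerBoundsAssemblyU3

end
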